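import Mathlib
import Summits.NavierStokesRegularity.NavierStokesRegularity.Theorems.LerayQuarterDissipationFiniteDissipationLiouvilleMixedRegion
import Summits.NavierStokesRegularity.NavierStokesRegularity.Theorems.LerayQuarterDissipationFiniteDissipationLiouvilleTrapping
import HarnessLib

/-!
# Crux `FiniteDissipationLiouville` (stmt-NavierStokesRegularity-22144): FORWARD TRAPPING inside the
# MIXED `(C, K)` LENS — the two mechanisms of lead g17 combined (file 1/2: the mixed slice-wise budget)

Theorems file of route `LerayQuarterDissipation` (lead prover g17; `--supports` the crux; sequel of
`…MixedRegion` and `…Trapping`). Navier–Stokes regularity is NOT proved by anything here; no summit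
is.

`𝒟_{C,K}`: Type-I ancient mild fields `V` (KNSS gauge, constant `C`) with Leray's quarter-rate law
`∫‖DV(t)‖² ≤ K/√(−t)`; `Z(s) = ∫‖Ω(s)‖²` the global similarity enstrophy (`= √(−t)∫‖ω(t)‖²dx`);
`K_S` Mathlib's Gagliardo–Nirenberg–Sobolev constant; `θ(k) = √k·(√K_S)³`.
`…Trapping` trapped the enstrophy below the number `64/27` of the pure `K`-rung by pricing each
slice by its own dissipation; `…MixedRegion` enlarged the `K`-rung to the lens
`λC²/μ + (1−λ)κ³θ(K)⁴ < 1` (weights with `2λμ + (1−λ)·3(1+δ)/(2κ) ≤ 2`). Here the slice-wise budget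
is priced by the MIXED bound, so the trapped region takes the shape of the lens:

* `two_mul_stretching_le_mixed_slice`, `deriv_sqCutoffEnstrophy_le_mixed_slice` — the mixed
  four-term bound and the damped budget with the dissipation hypothesis `∫‖DU(s)‖² ≤ K_U` used only
  AT the instant `s`: `Z_R'(s) ≤ (λC²/(2μ) + (1−λ)κ³θ(K_U)⁴/2 − ½)·Z_R(s) + (L/R)∫_{B̄_{2R}}‖Ω(s)‖²`;
* (file 2/2 `…TrappingMixed`: the abstract bootstrap `trapping_of_sliceBudget` and
  **`trapping_mixed_exp`** — one instant inside the lens traps the enstrophy with exponential decay;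
  `…EveryInstantMixed`: the lens-shaped every-instant floor.)

HONEST FRAMING. Statements about a HYPOTHETICAL object, explicit in Mathlib's non-sharp `K_S`, rate
`r` existential. Nothing is removed from the catalogued DSS wall (`∀ c > 1, TypeIDSSLiouville c`,
NECESSARY for the crux); verdict of the line unchanged (FRONTIER). Nothing here bears on Navier–Stokes
regularity or blow-up.

References: J. Leray, Acta Math. 63 (1934) §20; Robinson–Rodrigo–Sadowski, *The three-dimensional
Navier–Stokes equations* (2016) Thm 6.12 (invariant small-enstrophy region, bounded domains);
Koch–Nadirashvili–Seregin–Šverák, Acta Math. 203 (2009) §4; folklore energy method.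
-/

noncomputable section

set_option linter.dupNamespace false

namespace Summit.NavierStokesRegularity.NavierStokesRegularity.Theorems.FiniteDissipationLiouville.TrappingMixed

open MeasureTheory Set Filter Topology Metric InnerProductSpace Function Real
open scoped RealInnerProductSpace ContDiff ENNReal Laplacian
open Literature.Analysis Literature.Analysis.FluidPDE
open Summit.NavierStokesRegularity.NavierStokesRegularity.Theorems
open Summit.NavierStokesRegularity.NavierStokesRegularity.Theorems.GaussianGap
open Summit.NavierStokesRegularity.NavierStokesRegularity.Theorems.SimilarityEnstrophy
open Summit.NavierStokesRegularity.NavierStokesRegularity.Theorems.SmallDissipationGap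
open Summit.NavierStokesRegularity.NavierStokesRegularity.Theorems.FiniteDissipationLiouville.VorticityAmplitude
open Summit.NavierStokesRegularity.NavierStokesRegularity.Theorems.FiniteDissipationLiouville.Trapping

variable {C : ℝ} {V : ℝ → (EuclideanSpace ℝ (Fin 3)) → (EuclideanSpace ℝ (Fin 3))}

/-! ### The mixed slice-wise budget -/

section Slice

/-- **The mixed four-term stretching bound at ONE slice** (`…MixedRegion.two_mul_stretching_le_mixed`
with the dissipation hypothesis `∫‖DU(s)‖² ≤ K_U` used only at the instant `s`; `θ = √K_U(√K_S)³`,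
here not required positive: `m⁴ = κ·max θ θ₀` for any `θ₀ > 0` with `θ ≤ max θ θ₀`). For `R ≥ 1`:
`2∫φ_R²⟪DUΩ,Ω⟫ ≤ (2λμ + (1−λ)·3(1+δ)/(2κ))D_R + (λC²/(2μ) + (1−λ)κ³Θ⁴/2)Z_R + (c/R)I_{2R}`,
`Θ = max θ 1`. [folklore energy method; Ladyzhenskaya's inequality] -/
theorem two_mul_stretching_le_mixed_slice (hV : IsTypeIAncientMild C V) {c₁ : ℝ}
    (hc₁ : ∀ R : ℝ, 0 < R → ∀ y : EuclideanSpace ℝ (Fin 3),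
      ‖fderiv ℝ (fun z : EuclideanSpace ℝ (Fin 3) => smoothTransition (2 - ‖z‖ ^ 2 / R ^ 2)) y‖ ≤
        c₁ / R)
    {KU : ℝ} {s : ℝ} (hint : Integrable (fun y => ‖fderiv ℝ (lerayOrbit V s) y‖ ^ 2))
    (hKU : ∫ y, ‖fderiv ℝ (lerayOrbit V s) y‖ ^ 2 ≤ KU)
    {lam μ κ δ : ℝ} (hlam0 : 0 ≤ lam) (hlam1 : lam ≤ 1) (hμ : 0 < μ) (hκ : 0 < κ) (hδ : 0 < δ)
    {R : ℝ} (hR : 1 ≤ R) :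
    2 * (∫ y, smoothTransition (2 - ‖y‖ ^ 2 / R ^ 2) ^ 2 *
        ⟪fderiv ℝ (lerayOrbit V s) y (lerayVorticity V s y), lerayVorticity V s y⟫) ≤
      (2 * lam * μ + (1 - lam) * (3 * (1 + δ) / (2 * κ))) *
          (∫ y, smoothTransition (2 - ‖y‖ ^ 2 / R ^ 2) ^ 2 *
            frobeniusNormSq (fderiv ℝ (lerayVorticity V s) y)) +
        (lam * C ^ 2 / (2 * μ) + (1 - lam) *
            (κ ^ 3 * (max (Real.sqrt KU * Real.sqrt (SNormLESNormFDerivOfEqConst (EuclideanSpace ℝ (Fin 3))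
        (volume : Measure (EuclideanSpace ℝ (Fin 3))) 2 : ℝ) ^ 3) 1) ^ 4 / 2)) *
          (∫ y, smoothTransition (2 - ‖y‖ ^ 2 / R ^ 2) ^ 2 * ‖lerayVorticity V s y‖ ^ 2) +
        (lam * (4 * C * c₁) + (1 - lam) * (3 * (1 + δ⁻¹) * c₁ ^ 2 / (2 * κ))) / R *
          ∫ y in closedBall (0 : EuclideanSpace ℝ (Fin 3)) (2 * R), ‖lerayVorticity V s y‖ ^ 2 := by
  have hC : 0 ≤ C := hV.nonneg
  have hR0 : 0 < R := lt_of_lt_of_le one_pos hR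
  set θ : ℝ := Real.sqrt KU * Real.sqrt (SNormLESNormFDerivOfEqConst (EuclideanSpace ℝ (Fin 3))
        (volume : Measure (EuclideanSpace ℝ (Fin 3))) 2 : ℝ) ^ 3 with hθdef
  have hθ0 : 0 ≤ θ := by positivity
  set Θ : ℝ := max θ 1 with hΘdef
  have hΘpos : 0 < Θ := lt_of_lt_of_le one_pos (le_max_right _ _)
  have hθΘ : θ ≤ Θ := le_max_left _ _
  -- the Young weight `m` with `m⁴ = κ Θ`
  set q : ℝ := κ * Θ with hq
  have hqpos : 0 < q := mul_pos hκ hΘpos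
  set m : ℝ := Real.sqrt (Real.sqrt q) with hm
  have hmpos : 0 < m := Real.sqrt_pos.2 (Real.sqrt_pos.2 hqpos)
  have hm4 : m ^ 4 = q := by
    rw [show m ^ 4 = (m ^ 2) ^ 2 by ring, hm, Real.sq_sqrt (Real.sqrt_nonneg _),
      Real.sq_sqrt hqpos.le]
  have hm12 : m ^ 12 = q ^ 3 := by rw [show m ^ 12 = (m ^ 4) ^ 3 by ring, hm4]
  -- the two pricings
  have h1 := two_mul_integral_sqCutoff_stretching_le_typeI hV hc₁ hR0 s hμ
  have h2 := two_mul_integral_sqCutoff_stretching_le_weighted hV hc₁ hR0 s hint hKU hδ hmpos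
  rw [← hθdef] at h2
  set S := 2 * (∫ y, smoothTransition (2 - ‖y‖ ^ 2 / R ^ 2) ^ 2 *
      ⟪fderiv ℝ (lerayOrbit V s) y (lerayVorticity V s y), lerayVorticity V s y⟫) with hSdef
  set D := ∫ y, smoothTransition (2 - ‖y‖ ^ 2 / R ^ 2) ^ 2 *
      frobeniusNormSq (fderiv ℝ (lerayVorticity V s) y) with hDdef
  set Z := ∫ y, smoothTransition (2 - ‖y‖ ^ 2 / R ^ 2) ^ 2 * ‖lerayVorticity V s y‖ ^ 2 with hZdef
  set I := ∫ y in closedBall (0 : EuclideanSpace ℝ (Fin 3)) (2 * R), ‖lerayVorticity V s y‖ ^ 2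
    with hIdef
  have hI0 : 0 ≤ I := integral_nonneg fun y => sq_nonneg _
  have hZ0 : 0 ≤ Z := integral_nonneg fun y => mul_nonneg (sq_nonneg _) (sq_nonneg _)
  have hD0 : 0 ≤ D := integral_nonneg fun y => mul_nonneg (sq_nonneg _) (frobeniusNormSq_nonneg _)
  -- the Ladyzhenskaya coefficients with `m⁴ = κΘ`, `θ ≤ Θ`
  have hcoefZ : θ * m ^ 12 / 2 ≤ κ ^ 3 * Θ ^ 4 / 2 := by
    rw [hm12, hq]
    have : θ * (κ * Θ) ^ 3 ≤ Θ * (κ * Θ) ^ 3 := mul_le_mul_of_nonneg_right hθΘ (by positivity)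
    nlinarith only [this]
  have hcoefD : 3 * θ / (2 * m ^ 4) * (1 + δ) ≤ 3 * (1 + δ) / (2 * κ) := by
    rw [hm4, hq]
    rw [show 3 * θ / (2 * (κ * Θ)) * (1 + δ) = 3 * (1 + δ) / (2 * κ) * (θ / Θ) by
      field_simp]
    exact mul_le_of_le_one_right (by positivity) ((div_le_one hΘpos).2 hθΘ)
  have hcoefI : 3 * θ / (2 * m ^ 4) * (1 + δ⁻¹) ≤ 3 * (1 + δ⁻¹) / (2 * κ) := by
    rw [hm4, hq]
    rw [show 3 * θ / (2 * (κ * Θ)) * (1 + δ⁻¹) = 3 * (1 + δ⁻¹) / (2 * κ) * (θ / Θ) by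
      field_simp]
    exact mul_le_of_le_one_right (by positivity) ((div_le_one hΘpos).2 hθΘ)
  -- `(c₁/R)² ≤ c₁²/R` for `R ≥ 1`
  have hc₁R : (c₁ / R) ^ 2 ≤ c₁ ^ 2 / R := by
    rw [div_pow, div_le_div_iff₀ (by positivity) hR0]
    have : c₁ ^ 2 * R ≤ c₁ ^ 2 * R ^ 2 := by
      apply mul_le_mul_of_nonneg_left _ (sq_nonneg _)
      nlinarith
    linarith
  have h2' : S ≤ κ ^ 3 * Θ ^ 4 / 2 * Z + 3 * (1 + δ) / (2 * κ) * D +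
      3 * (1 + δ⁻¹) / (2 * κ) * (c₁ ^ 2 / R) * I := by
    have a1 := mul_le_mul_of_nonneg_right hcoefZ hZ0
    have a2 := mul_le_mul_of_nonneg_right hcoefD hD0
    have hδi : 0 ≤ 3 * (1 + δ⁻¹) / (2 * κ) := by positivity
    have hθm : 0 ≤ 3 * θ / (2 * m ^ 4) * (1 + δ⁻¹) := by positivity
    have a3 : 3 * θ / (2 * m ^ 4) * (1 + δ⁻¹) * (c₁ / R) ^ 2 * I ≤
        3 * (1 + δ⁻¹) / (2 * κ) * (c₁ ^ 2 / R) * I := by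
      have := mul_le_mul hcoefI hc₁R (sq_nonneg _) hδi
      exact mul_le_mul_of_nonneg_right this hI0
    linarith [h2]
  -- the convex combination
  have hsplit : S = lam * S + (1 - lam) * S := by ring
  have hl1 : lam * S ≤ lam * (2 * μ * D + C ^ 2 / (2 * μ) * Z + 4 * C * (c₁ / R) * I) :=
    mul_le_mul_of_nonneg_left h1 hlam0
  have hl2 : (1 - lam) * S ≤ (1 - lam) * (κ ^ 3 * Θ ^ 4 / 2 * Z + 3 * (1 + δ) / (2 * κ) * D +
      3 * (1 + δ⁻¹) / (2 * κ) * (c₁ ^ 2 / R) * I) :=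
    mul_le_mul_of_nonneg_left h2' (by linarith)
  have e : lam * (2 * μ * D + C ^ 2 / (2 * μ) * Z + 4 * C * (c₁ / R) * I) +
      (1 - lam) * (κ ^ 3 * Θ ^ 4 / 2 * Z + 3 * (1 + δ) / (2 * κ) * D +
        3 * (1 + δ⁻¹) / (2 * κ) * (c₁ ^ 2 / R) * I) =
      (2 * lam * μ + (1 - lam) * (3 * (1 + δ) / (2 * κ))) * D +
        (lam * C ^ 2 / (2 * μ) + (1 - lam) * (κ ^ 3 * Θ ^ 4 / 2)) * Z +
        (lam * (4 * C * c₁) + (1 - lam) * (3 * (1 + δ⁻¹) * c₁ ^ 2 / (2 * κ))) / R * I := by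
    field_simp
    ring
  linarith

/-- **The MIXED slice-wise damped budget.** For a KNSS-gauge Type-I field `V` with constant `C`, a
level `K_U`, and weights `0 ≤ λ ≤ 1`, `μ, κ, δ > 0` not overspending the dissipation
(`2λμ + (1−λ)·3(1+δ)/(2κ) ≤ 2`), there is `L ≥ 0` such that at every instant `s` with
`∫‖DU(s)‖² ≤ K_U` and every `R ≥ 1`:
`Z_R'(s) ≤ (λC²/(2μ) + (1−λ)κ³Θ⁴/2 − ½)·Z_R(s) + (L/R)·∫_{B̄_{2R}}‖Ω(s)‖²`, `Θ = max (√K_U(√K_S)³) 1`.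
[folklore energy method] -/
theorem deriv_sqCutoffEnstrophy_le_mixed_slice (hV : IsTypeIAncientMild C V) {KU lam μ κ δ : ℝ}
    (hlam0 : 0 ≤ lam) (hlam1 : lam ≤ 1) (hμ : 0 < μ) (hκ : 0 < κ) (hδ : 0 < δ)
    (H1 : 2 * lam * μ + (1 - lam) * (3 * (1 + δ) / (2 * κ)) ≤ 2) :
    ∃ L : ℝ, 0 ≤ L ∧ ∀ R : ℝ, 1 ≤ R → ∀ s : ℝ,
      Integrable (fun y => ‖fderiv ℝ (lerayOrbit V s) y‖ ^ 2) →
      (∫ y, ‖fderiv ℝ (lerayOrbit V s) y‖ ^ 2 ≤ KU) →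
      deriv (fun σ => ∫ y, smoothTransition (2 - ‖y‖ ^ 2 / R ^ 2) ^ 2 * ‖lerayVorticity V σ y‖ ^ 2) s ≤
        (lam * C ^ 2 / (2 * μ) + (1 - lam) *
            (κ ^ 3 * (max (Real.sqrt KU * Real.sqrt (SNormLESNormFDerivOfEqConst (EuclideanSpace ℝ (Fin 3))
        (volume : Measure (EuclideanSpace ℝ (Fin 3))) 2 : ℝ) ^ 3) 1) ^ 4 / 2) - 1 / 2) *
          (∫ y, smoothTransition (2 - ‖y‖ ^ 2 / R ^ 2) ^ 2 * ‖lerayVorticity V s y‖ ^ 2) +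
          L / R * ∫ y in closedBall (0 : (EuclideanSpace ℝ (Fin 3))) (2 * R), ‖lerayVorticity V s y‖ ^ 2 := by
  obtain ⟨c₁, hc₁0, hc₁⟩ :=
    exists_norm_fderiv_smoothTransition_cutoff_le (E := (EuclideanSpace ℝ (Fin 3)))
  obtain ⟨c₂, hc₂0, hc₂⟩ :=
    exists_abs_laplacian_smoothTransition_cutoff_le (E := (EuclideanSpace ℝ (Fin 3)))
  have hC : 0 ≤ C := hV.nonneg
  have h1lam : 0 ≤ 1 - lam := by linarith
  refine ⟨2 * C * c₁ + 2 * c₂ + 6 * c₁ ^ 2 +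
      (lam * (4 * C * c₁) + (1 - lam) * (3 * (1 + δ⁻¹) * c₁ ^ 2 / (2 * κ))),
    by positivity, fun R hR1 s hint hKUs => ?_⟩
  have hR : 0 < R := lt_of_lt_of_le one_pos hR1
  rw [deriv_sqCutoffEnstrophy_eq hV hR s]
  set φ : (EuclideanSpace ℝ (Fin 3)) → ℝ := fun z => smoothTransition (2 - ‖z‖ ^ 2 / R ^ 2) with hφdef
  set Ω := lerayVorticity V s with hΩdef
  set U := lerayOrbit V s with hUdef
  set I : ℝ := ∫ y in closedBall (0 : (EuclideanSpace ℝ (Fin 3))) (2 * R), ‖Ω y‖ ^ 2 with hIdef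
  set Z : ℝ := ∫ y, φ y ^ 2 * ‖Ω y‖ ^ 2 with hZdef
  set D : ℝ := ∫ y, φ y ^ 2 * frobeniusNormSq (fderiv ℝ Ω y) with hDdef
  have hI0 : 0 ≤ I := integral_nonneg fun y => sq_nonneg _
  have hZ0 : 0 ≤ Z := integral_nonneg fun y => mul_nonneg (sq_nonneg _) (sq_nonneg _)
  have hD0 : 0 ≤ D := integral_nonneg fun y => mul_nonneg (sq_nonneg _) (frobeniusNormSq_nonneg _)
  have hΩ1 : ContDiff ℝ 1 Ω := signedBudget_contDiff_lerayVorticity_slice hV s (n := 1)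
  have hcΩ : Continuous Ω := hΩ1.continuous
  have hUC : ∀ y, ‖U y‖ ≤ C := fun y => norm_lerayOrbit_le_of_typeI hV s y
  have hw1 : ContDiff ℝ 1 fun z : (EuclideanSpace ℝ (Fin 3)) => φ z ^ 2 := contDiff_sqCutoff (n := 1) R
  have hw2 : ContDiff ℝ 2 fun z : (EuclideanSpace ℝ (Fin 3)) => φ z ^ 2 := contDiff_sqCutoff (n := 2) R
  have hcDw : Continuous (fderiv ℝ fun z : (EuclideanSpace ℝ (Fin 3)) => φ z ^ 2) :=
    hw1.continuous_fderiv one_ne_zero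
  -- (1) drift flux `≤ 0`
  have hDrift : (∫ y, fderiv ℝ (fun z : (EuclideanSpace ℝ (Fin 3)) => φ z ^ 2) y y * ‖Ω y‖ ^ 2) ≤ 0 :=
    integral_nonpos fun y => mul_nonpos_iff.2 (Or.inr ⟨fderiv_sqCutoff_self_nonpos R y, sq_nonneg _⟩)
  -- (2) transport flux
  have hT : |∫ y, fderiv ℝ (fun z : (EuclideanSpace ℝ (Fin 3)) => φ z ^ 2) y (U y) * ‖Ω y‖ ^ 2| ≤
      C * (2 * (c₁ / R)) * I := by
    refine abs_integral_le_of_weight_sq hcΩ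
      (w := fun y => C * ‖fderiv ℝ (fun z : (EuclideanSpace ℝ (Fin 3)) => φ z ^ 2) y‖)
      (continuous_const.mul hcDw.norm) (fun y hy => ?_) (fun y _ => ?_) (fun y => ?_)
    · show C * ‖fderiv ℝ (fun z : (EuclideanSpace ℝ (Fin 3)) => φ z ^ 2) y‖ = 0
      rw [hφdef, fderiv_sqCutoff_eq_zero hR hy, norm_zero, mul_zero]
    · exact mul_le_mul_of_nonneg_left (norm_fderiv_sqCutoff_le hc₁ hR y) hC
    · rw [abs_mul, abs_of_nonneg (sq_nonneg ‖Ω y‖)]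
      have e1 : |fderiv ℝ (fun z : (EuclideanSpace ℝ (Fin 3)) => φ z ^ 2) y (U y)| ≤
          ‖fderiv ℝ (fun z : (EuclideanSpace ℝ (Fin 3)) => φ z ^ 2) y‖ * C := by
        rw [← Real.norm_eq_abs]
        exact (ContinuousLinearMap.le_opNorm _ _).trans
          (mul_le_mul_of_nonneg_left (hUC y) (norm_nonneg _))
      calc |fderiv ℝ (fun z : (EuclideanSpace ℝ (Fin 3)) => φ z ^ 2) y (U y)| * ‖Ω y‖ ^ 2
          ≤ (‖fderiv ℝ (fun z : (EuclideanSpace ℝ (Fin 3)) => φ z ^ 2) y‖ * C) * ‖Ω y‖ ^ 2 :=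
            mul_le_mul_of_nonneg_right e1 (sq_nonneg _)
        _ = C * ‖fderiv ℝ (fun z : (EuclideanSpace ℝ (Fin 3)) => φ z ^ 2) y‖ * ‖Ω y‖ ^ 2 := by ring
  -- (3) viscous flux
  have hVisc : |∫ y, ‖Ω y‖ ^ 2 * (Δ (fun z : (EuclideanSpace ℝ (Fin 3)) => φ z ^ 2)) y| ≤
      (2 * (c₂ / R ^ 2) + 6 * (c₁ / R) ^ 2) * I := by
    refine abs_integral_le_of_weight_sq hcΩ
      (w := fun y => |(Δ (fun z : (EuclideanSpace ℝ (Fin 3)) => φ z ^ 2)) y|)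
      (continuous_laplacian hw2).abs (fun y hy => ?_) (fun y _ => ?_) (fun y => ?_)
    · show |(Δ (fun z : (EuclideanSpace ℝ (Fin 3)) => φ z ^ 2)) y| = 0
      rw [hφdef, laplacian_sqCutoff_eq_zero hR hy, abs_zero]
    · exact abs_laplacian_sqCutoff_le hc₁ hc₂ hR y
    · rw [abs_mul, abs_of_nonneg (sq_nonneg ‖Ω y‖), mul_comm]
  -- (4) stretching, mixed pricing at THIS slice
  have hS := two_mul_stretching_le_mixed_slice hV hc₁ hint hKUs hlam0 hlam1 hμ hκ hδ hR1
  have hDsp := mul_le_mul_of_nonneg_right H1 hD0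
  -- absorption of the collar terms
  have hT' := (le_abs_self _).trans hT
  have hVisc' := (le_abs_self _).trans hVisc
  have hR2 : 1 / R ^ 2 ≤ 1 / R := by
    apply one_div_le_one_div_of_le hR
    nlinarith
  have hc₂R : c₂ / R ^ 2 ≤ c₂ / R := by
    have := mul_le_mul_of_nonneg_left hR2 hc₂0
    simpa only [mul_one_div] using this
  have hc₁R : (c₁ / R) ^ 2 ≤ c₁ ^ 2 / R := by
    rw [div_pow]
    have := mul_le_mul_of_nonneg_left hR2 (sq_nonneg c₁)
    simpa only [mul_one_div] using this
  have a4 : (2 * (c₂ / R ^ 2) + 6 * (c₁ / R) ^ 2) * I ≤ (2 * (c₂ / R) + 6 * (c₁ ^ 2 / R)) * I :=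
    mul_le_mul_of_nonneg_right (by linarith [hc₂R, hc₁R]) hI0
  have e : (2 * C * c₁ + 2 * c₂ + 6 * c₁ ^ 2 +
      (lam * (4 * C * c₁) + (1 - lam) * (3 * (1 + δ⁻¹) * c₁ ^ 2 / (2 * κ)))) / R * I =
      C * (2 * (c₁ / R)) * I + (2 * (c₂ / R) + 6 * (c₁ ^ 2 / R)) * I +
        (lam * (4 * C * c₁) + (1 - lam) * (3 * (1 + δ⁻¹) * c₁ ^ 2 / (2 * κ))) / R * I := by
    field_simp
    ring
  rw [e]
  have eZ : (lam * C ^ 2 / (2 * μ) + (1 - lam) *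
      (κ ^ 3 * (max (Real.sqrt KU * Real.sqrt (SNormLESNormFDerivOfEqConst (EuclideanSpace ℝ (Fin 3))
        (volume : Measure (EuclideanSpace ℝ (Fin 3))) 2 : ℝ) ^ 3) 1) ^ 4 / 2) - 1 / 2) * Z =
      -(1 / 2) * Z + (lam * C ^ 2 / (2 * μ) + (1 - lam) *
        (κ ^ 3 * (max (Real.sqrt KU * Real.sqrt (SNormLESNormFDerivOfEqConst (EuclideanSpace ℝ (Fin 3))
        (volume : Measure (EuclideanSpace ℝ (Fin 3))) 2 : ℝ) ^ 3) 1) ^ 4 / 2)) * Z := by ring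
  linarith [hDrift, hT', hVisc', hS, hDsp, a4, eZ]

end Slice

end Summit.NavierStokesRegularity.NavierStokesRegularity.Theorems.FiniteDissipationLiouville.TrappingMixed

end
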